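import Summits.BirchSwinnertonDyer.BirchSwinnertonDyer.Theorems.ByReductionTypeAtTwoMultUpperHalfTowerAcur
import Summits.BirchSwinnertonDyer.BirchSwinnertonDyer.Theorems.ByReductionTypeAtTwoTowerLayerKatoHalf
import HarnessLib

/-!
# The EXPONENT certificate of the relaxed layer group `A_n[2]` composed with the item doors — the shape a «REL-χ TOP»
# certificate displays (route ByReductionTypeAtTwo; items stmt-BirchSwinnertonDyer-19271 `OrdKatoHalfAtTwo` (home) and
# stmt-BirchSwinnertonDyer-19922 `MultUpperHalfAtTwo` (rows); seat bsd-2adic-tower-1 GEN 17, D-0074 (T1))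

HONEST FRAMING (cell `bsd-2adic`, run/shared/lean/pub/bsd-2adic/, HUMAN RULINGS D-0036/D-0054/D-0074): door THEOREMS only;
no definition, no new named fact, no `sorry`; they close no item by themselves; nothing is booked; BSD is not proved by any of
this. PARTITION: X5@2 TOWER rows at the LAYER-4 WALL (good-ordinary 19271: the `E[2]`-irreducible no-file classes; multiplicative
19922: the LAYER-4 customers of the A-currency residue) × p = 2 — types-the-object-of (a numeral-free certificate FORMAT);
closes none.

WHAT. GEN 13's exponent door `TowerFiltration.towerGapAtTwo_of_exponent_classes` (file `…TowerFiltrationClasses`):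
`2 ∤ #E(ℚ)_tors`, `b < 2ⁿ`, and `(conj_γ − id)^[b]` KILLS `A_n[2]` (`A_n = h_n⁻¹(Sel_{2^∞}(E/ℚ_∞))`, every cyclotomic `κ`, every
topological generator `γ`) ⟹ `O1.TowerGapAtTwo W` (window `(b, 1)`: `#X/(2,T^{b+1})X = #X/(2,T^b)X`). This file composes it:
* `towerGapAtTwo_of_exponent_classes_of_irr` — the same at an `E[2]`-irreducible curve (odd torsion for free,
  `not_two_dvd_torsionOrder_of_irr_two`);
* `katoHalfAt_two_of_exponent_classes` — item 19271 AT `W`: Kato 17.4 (1)(2)@2 (`h17`) + Néron integrality (`hper₀`) + good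
  ordinary `2` + the exponent certificate ⟹ `O1.MainConjectureLowerDivisibilityAtTwoOrd W` (via `KatoHalfPinch.katoHalfAt_two_of_towerGap_of_neron`);
* `missingUpperBoundAt_two_of_exponent_classes` / `bsdp_two_of_exponent_classes` — item 19922 AT a rank-0, multiplicative-at-2,
  `E[2]`-irreducible `W` (via `missingUpperBoundAt_two_mult_of_towerGapMember'`), displaying VERBATIM the PRINT/MEMO binders of the
  A-currency doors of `…MultUpperHalfTowerAcur` {`hKato`, `h41ns'`, `h41sp`, `hmod`, `hGZK`, `hCassels`, `hC`, `hGS`}.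

WHY THIS SHAPE (tower/NOTE-RELCHI-GEN17.md §4; nothing of it is asserted here). The «REL-χ TOP» test reads, at layer `j`, the Hilbert
symbols `(2 + y_j, ·)_𝔓` of the induced basis at the primes of `L_j = ℚ_j[x]/(f)` over the places of `ℚ_j` that do not split in
`ℚ_{j+1}`; when the symbol functionals separate the top `(σ−1)`-layer of the upper induced group, `(σ'−1)^{2^{j+1} − 1}` kills
`A_{j+1}[2]` — exactly the hypothesis `hkill` below with `n = j + 1`, `b = 2^{j+1} − 1`. A class file displaying `hkill` on that
basis says so in its docstring («inferred exponent; no layer-(j+1) descent was run») — instrument evidence tier, two engines wanted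
(RC-182), the referees decide its tier. With a layer-`n` descent that simply OBSERVES `(σ−1)^[b] A_n[2] = 0` the same doors apply verbatim.

References: R. Greenberg, LNM 1716 (1999) §1 p. 60, §3 pp. 85–86 (Lemmas 3.1, 3.2); L. Washington, *Introduction to Cyclotomic
Fields* §13.2; K. Kato, Astérisque 295 (2004) Thm. 17.4; K. Česnavičius, Duke Math. J. 167 (2018) Thm. 1.2; R. L. Miller, LMS J.
Comput. Math. 14 (2011) Def. 1.1; the docstrings of the two imported files.
-/

set_option autoImplicit false
-- the Theorems namespace of this sub repeats the summit name by design (D-0017 nested layout: Summit.<S>.<Sub>)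
set_option linter.dupNamespace false

noncomputable section

open scoped Classical MatrixGroups ModularForm

open NumberField IsDedekindDomain CongruenceSubgroup WeierstrassCurve Literature.NumberTheory.EllipticCurves
  Literature.NumberTheory.EllipticCurves.ModularForms Literature.NumberTheory.EllipticCurves.Rank1Residual
  Literature.NumberTheory.EllipticCurves.Rank1Residual.Typed
  Literature.NumberTheory.EllipticCurves.Greenberg1999
  Summit.BirchSwinnertonDyer.Rank1Residual.X5 Summit.BirchSwinnertonDyer.Rank1Residual.X5.O1
  Summit.BirchSwinnertonDyer.BirchSwinnertonDyer.Theorems.KatoHalfPinch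
  Summit.BirchSwinnertonDyer.BirchSwinnertonDyer.Theorems.Rank1ResidualX1Defs

namespace Summit.BirchSwinnertonDyer.BirchSwinnertonDyer.Theorems.TowerRelChi

section Curve

variable (W : WeierstrassCurve ℚ) [W.IsElliptic] [W.IsGloballyMinimal]

/-- **The EXPONENT certificate at an `E[2]`-irreducible curve**: `Irr W 2` (so `2 ∤ #E(ℚ)_tors`), `b < 2ⁿ`, and
`(conj_γ − id)^[b] z = 0` for every `2`-torsion class `z` of `A_n = h_n⁻¹(Sel_{2^∞}(E/ℚ_∞))`, every cyclotomic `κ`, every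
topological generator `γ` ⟹ `O1.TowerGapAtTwo W`. [cite: GreenbergLNM1716, §1 p. 60 and §3 pp. 85–86 (Lemmas 3.1, 3.2)]
[cite: Washington1997, §13.2] -/
theorem towerGapAtTwo_of_exponent_classes_of_irr (hirr : Irr W 2) {n b : ℕ} (hb : b < 2 ^ n)
    (hkill : ∀ (κ : ZpExtension ℚ 2) (γ : Field.absoluteGaloisGroup ℚ), κ.IsCyclotomic →
      κ.IsTopGenerator γ → ∀ z : W.selmerInftyPreimage κ n, 2 • z = 0 →
        (⇑(W.conjH1 2 (κ.layerSubgroup n) γ -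
          AddMonoidHom.id (W.subgroupH1 2 (κ.layerSubgroup n))))^[b]
          (z : W.subgroupH1 2 (κ.layerSubgroup n)) = 0) : TowerGapAtTwo W :=
  TowerFiltration.towerGapAtTwo_of_exponent_classes W (not_two_dvd_torsionOrder_of_irr_two W hirr) hb hkill

/-- **Item `OrdKatoHalfAtTwo` AT `W` from the EXPONENT certificate.** PRINT: Kato 17.4 (1)(2)@2 (`h17`). CERTIFICATES: Néron
integrality `hper₀`, odd torsion, `b < 2ⁿ`, `(conj_γ − id)^[b]` kills `A_n[2]`. Good ordinary `2`. No `λ_an`/`μ_an`/`hrank`, any analytic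
rank, NO local datum. [cite: Kato2004Asterisque, Thm. 17.4 (1)(2) (p. 273)] [cite: GreenbergLNM1716, §1 p. 60 and §3 pp. 85–86] -/
theorem katoHalfAt_two_of_exponent_classes
    (h17 : ∀ [NeZero (W.conductorNorm ℤ)] (f : CuspForm (Gamma0 (W.conductorNorm ℤ)) 2),
      kato_divisibility_allPrimes W 2 (f := f))
    (hper₀ : ∀ [NeZero (W.conductorNorm ℤ)] (f : CuspForm (Gamma0 (W.conductorNorm ℤ)) 2),
      IsNewformOf W f → ∀ ϖ : ℚ, (ϖ : ℝ) * W.realPeriodRat = plusPeriod f → 0 ≤ padicValRat 2 ϖ)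
    (hgo : GoodOrd W 2) (htors : ¬ 2 ∣ W.torsionOrder) {n b : ℕ} (hb : b < 2 ^ n)
    (hkill : ∀ (κ : ZpExtension ℚ 2) (γ : Field.absoluteGaloisGroup ℚ), κ.IsCyclotomic →
      κ.IsTopGenerator γ → ∀ z : W.selmerInftyPreimage κ n, 2 • z = 0 →
        (⇑(W.conjH1 2 (κ.layerSubgroup n) γ -
          AddMonoidHom.id (W.subgroupH1 2 (κ.layerSubgroup n))))^[b]
          (z : W.subgroupH1 2 (κ.layerSubgroup n)) = 0) : MainConjectureLowerDivisibilityAtTwoOrd W :=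
  katoHalfAt_two_of_towerGap_of_neron W h17 hper₀ hgo
    (TowerFiltration.towerGapAtTwo_of_exponent_classes W htors hb hkill)

/-- **UPPER HALF at a rank-0, multiplicative-at-2, `E[2]`-irreducible `W` from the EXPONENT certificate of `A_n[2]`.**
PRINT {`h41ns'`, `h41sp`, `hmod`, `hGZK`, `hCassels`, `hC`} + MEMO {`hKato` (RC-2), `hGS` (RC-4)} + CERTIFICATES {`hr`, `hb`, `hkill`};
NO count, NO local datum. [cite: GreenbergLNM1716, §3 pp. 85–94 and §4 pp. 112–113] [cite: Cesnavicius2018, Thm. 1.2] [cite: Miller2011LMS, Def. 1.1] -/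
theorem missingUpperBoundAt_two_of_exponent_classes
    (hKato : ∀ (W : WeierstrassCurve ℚ) [W.IsElliptic] [W.IsGloballyMinimal],
      ¬ W.HasCM → Mult W 2 → O1.KatoMultiplicativeDivisibilityRat W 2)
    (h41ns' : thm41Analogue_charValue_rankZero_numberField_anyPrime_oddLocalDegree)
    (h41sp : thm41Analogue_charValue_rankZero_split_baseChange_anyPrime)
    (hmod : nonempty_modularParametrizationData)
    (hGZK : rank_eq_analyticRank_of_analyticRank_le_one)
    (hCassels : bsdRHS_eq_of_isIsogenous)
    (hC : cesnavicius_not_two_dvd_maninConstant_of_two_dvd_level)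
    (hGS : ∀ (W : WeierstrassCurve ℚ) [W.IsElliptic] [W.IsGloballyMinimal],
      W.HasSplitMultiplicativeReductionAtPrime 2 → greenberg_stevens (W := W) (p := 2))
    (hr : W.analyticRank = 0) (hmult : Mult W 2) (hirr : Irr W 2) {n b : ℕ} (hb : b < 2 ^ n)
    (hkill : ∀ (κ : ZpExtension ℚ 2) (γ : Field.absoluteGaloisGroup ℚ), κ.IsCyclotomic →
      κ.IsTopGenerator γ → ∀ z : W.selmerInftyPreimage κ n, 2 • z = 0 →
        (⇑(W.conjH1 2 (κ.layerSubgroup n) γ -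
          AddMonoidHom.id (W.subgroupH1 2 (κ.layerSubgroup n))))^[b]
          (z : W.subgroupH1 2 (κ.layerSubgroup n)) = 0) : MissingUpperBoundAt W 2 :=
  missingUpperBoundAt_two_mult_of_towerGapMember' hKato h41ns' h41sp hmod hGZK hCassels hC hGS W hr hmult W
    (IsIsogenous.refl_holds W) (towerGapAtTwo_of_exponent_classes_of_irr W hirr hb hkill) (Or.inl hirr)

/-- **`BSDp W 2` at a rank-0, multiplicative-at-2, `E[2]`-irreducible `W` from the EXPONENT certificate of `A_n[2]` + the descent
inequality `hsha : MissingLowerBoundAt W 2`.** [cite: Miller2011LMS, Def. 1.1] [cite: GreenbergLNM1716, §3 pp. 85–94] -/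
theorem bsdp_two_of_exponent_classes
    (hKato : ∀ (W : WeierstrassCurve ℚ) [W.IsElliptic] [W.IsGloballyMinimal],
      ¬ W.HasCM → Mult W 2 → O1.KatoMultiplicativeDivisibilityRat W 2)
    (h41ns' : thm41Analogue_charValue_rankZero_numberField_anyPrime_oddLocalDegree)
    (h41sp : thm41Analogue_charValue_rankZero_split_baseChange_anyPrime)
    (hmod : nonempty_modularParametrizationData)
    (hGZK : rank_eq_analyticRank_of_analyticRank_le_one)
    (hCassels : bsdRHS_eq_of_isIsogenous)
    (hC : cesnavicius_not_two_dvd_maninConstant_of_two_dvd_level)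
    (hGS : ∀ (W : WeierstrassCurve ℚ) [W.IsElliptic] [W.IsGloballyMinimal],
      W.HasSplitMultiplicativeReductionAtPrime 2 → greenberg_stevens (W := W) (p := 2))
    (hr : W.analyticRank = 0) (hmult : Mult W 2) (hirr : Irr W 2) {n b : ℕ} (hb : b < 2 ^ n)
    (hkill : ∀ (κ : ZpExtension ℚ 2) (γ : Field.absoluteGaloisGroup ℚ), κ.IsCyclotomic →
      κ.IsTopGenerator γ → ∀ z : W.selmerInftyPreimage κ n, 2 • z = 0 →
        (⇑(W.conjH1 2 (κ.layerSubgroup n) γ -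
          AddMonoidHom.id (W.subgroupH1 2 (κ.layerSubgroup n))))^[b]
          (z : W.subgroupH1 2 (κ.layerSubgroup n)) = 0)
    (hsha : MissingLowerBoundAt W 2) : BSDp W 2 :=
  bsdp_of_missingPPartAt W 2 hGZK (hr.le.trans zero_le_one)
    (missingPPartAt_of_lower_of_upper W 2 hsha
      (missingUpperBoundAt_two_of_exponent_classes W hKato h41ns' h41sp hmod hGZK hCassels hC hGS hr hmult hirr hb hkill))

end Curve

end Summit.BirchSwinnertonDyer.BirchSwinnertonDyer.Theorems.TowerRelChi

end
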